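import Summits.CriticalPhenomena.Ising3DConformalLimit.Theorems.PrecisionLaplacianDirectCorrelationStableTailSpectralParseval
import Summits.CriticalPhenomena.Ising3DConformalLimit.Theorems.PrecisionLaplacianDirectCorrelationStableTailSpectralBallMass
import Summits.CriticalPhenomena.Ising3DConformalLimit.Theorems.PrecisionLaplacianDirectCorrelationStableTailSpectralTailBound
import Summits.CriticalPhenomena.Ising3DConformalLimit.Theorems.PrecisionLaplacianDirectCorrelationStableTailBoxDoubleSumBounds
import Summits.CriticalPhenomena.Ising3DConformalLimit.Theorems.PrecisionLaplacianDirectCorrelationStableTailSpectralIsotropy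
import Summits.CriticalPhenomena.Ising3DConformalLimit.Theorems.PrecisionLaplacianDirectCorrelationStableTailShiftedBoxWeightLower
import HarnessLib

/-!
# The two-scale spectral shell bound — D2 glue (Fourier side) of line `diffusive-branch-is-nonsaturation`,
# crux `PrecisionLaplacian.DirectCorrelationStableTail` (stmt-CriticalPhenomena-4799)

Pure theorem file (no definitions), Ising-free.  For a nonnegative, even, hyperoctahedrally symmetric kernel
`G ≤ 1` on `ℤ³` all of whose finite quadratic forms are nonnegative, with the infrared envelope `G ≤ C₀/‖x‖∞`,
the quadratic form of the shifted-box vector `v = 𝟙_{Λ_{R'}} − 𝟙_{Λ_{R'}+y}` (`‖y‖∞ ≤ R'`) is bounded BELOW by a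
spectral-shell expression: combining the landed stubs A (Parseval, p128425), B (autocorrelation count), C (ball
mass, p128429), D (dyadic tail, p128722), F (isotropy, p128556), G (Dirichlet lower bound for `v̂`, p128464) at
the level of the approximate spectral density `g̃_L(k) = Σ_{z,z'∈Λ_L} G(z'−z)cos k·(z'−z)` on the cube
`K = [-π,π]³`, dividing by `(2L+1)³` and letting `L → ∞`:

`(2π)³ ⟨v, G v⟩ ≥ (1/160)(2R'+1)⁶(|y|₂²/3)ρ₁² · ( [(2π)³ Σ_{x,x'∈Λ_R} G(x'−x) − C_tl (2R+1)⁴(2R'+1)]/(2R+1)⁶ − C_M ρ₁ )`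

for every auxiliary box size `R` and every `0 < ρ₁ ≤ 1/(2R'+1)`, with `C_M = 64(2π)³(54C₀+2)` and
`C_tl = 40 C_M + 60 (2π)³` (`spectralShell_quadForm_lower`).  Under saturation `Σ_{Λ_R²} G ≳ ε(2R+1)⁵` (stub E)
the right-hand side is `≳ (2R'+1)³|y|²` for suitable `R ≍ R'`, `ρ₁ ≍ 1/R'` — used in
`…NonSaturationOfInfiniteVariance.lean`.
-/

noncomputable section

namespace Summit.CriticalPhenomena.Ising3DConformalLimit.Cruxes.DirectCorrelationStableTail.DiffusiveBranchIsNonsaturation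

open MeasureTheory Filter Topology
open scoped BigOperators
open Literature.Probability.LatticeModels
open Literature.Barriers.CriticalPhenomena.SpreadOutIsing (dirichletRowSum)
open Summit.CriticalPhenomena.Ising3DConformalLimit.Theorems

/-! ### Small facts -/

/-- The approximate spectral density of a kernel with nonnegative finite quadratic forms is nonnegative:
`g̃_L(k) = Q(cos k·) + Q(sin k·) ≥ 0`. [folklore] -/
theorem approxSpectralDensity_nonneg (G : Site 3 → ℝ)
    (hpos : ∀ (A : Finset (Site 3)) (c : Site 3 → ℝ), 0 ≤ ∑ x ∈ A, ∑ x' ∈ A, c x * c x' * G (x' - x))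
    (L : ℕ) (k : Fin 3 → ℝ) :
    0 ≤ ∑ z ∈ box 3 L, ∑ z' ∈ box 3 L, G (z' - z) * Real.cos (phase 3 k (z' - z)) := by
  have h : ∑ z ∈ box 3 L, ∑ z' ∈ box 3 L, G (z' - z) * Real.cos (phase 3 k (z' - z))
      = (∑ z ∈ box 3 L, ∑ z' ∈ box 3 L,
          Real.cos (phase 3 k z) * Real.cos (phase 3 k z') * G (z' - z)) +
        ∑ z ∈ box 3 L, ∑ z' ∈ box 3 L,
          Real.sin (phase 3 k z) * Real.sin (phase 3 k z') * G (z' - z) := by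
    rw [← Finset.sum_add_distrib]
    refine Finset.sum_congr rfl fun z _ => ?_
    rw [← Finset.sum_add_distrib]
    refine Finset.sum_congr rfl fun z' _ => ?_
    rw [phase_sub, Real.cos_sub]
    ring
  rw [h]
  exact add_nonneg (hpos _ _) (hpos _ _)

/-- Total mass of the approximate spectral density: `∫_K g̃_L = (2π)³ G(0) (2L+1)³ ≤ (2π)³(2L+1)³` when
`G 0 ≤ 1`. [folklore] -/
theorem integral_approxSpectralDensity_le (G : Site 3 → ℝ) (hGev : ∀ w, G (-w) = G w) (hG0 : G 0 ≤ 1)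
    (L : ℕ) :
    ∫ k in Set.pi Set.univ (fun _ : Fin 3 => Set.Icc (-Real.pi) Real.pi),
        (∑ z ∈ box 3 L, ∑ z' ∈ box 3 L, G (z' - z) * Real.cos (phase 3 k (z' - z)))
      ≤ (2 * Real.pi) ^ 3 * (2 * L + 1) ^ 3 := by
  have h := integral_cos_mul_approxSpectralDensity G hGev L 0
  have h0 : ∀ k : Fin 3 → ℝ, Real.cos (phase 3 k 0) = 1 := by
    intro k; simp [phase]
  simp_rw [h0, one_mul] at h
  rw [h]
  have hc := autocorrelationCount_le (0 : Site 3) L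
  have hc' : ((((box 3 L) ×ˢ (box 3 L)).filter (fun p : Site 3 × Site 3 => p.2 - p.1 = 0)).card : ℝ)
      ≤ (2 * L + 1) ^ 3 := by exact_mod_cast hc
  have hπ : (0 : ℝ) ≤ (2 * Real.pi) ^ 3 := by positivity
  calc (2 * Real.pi) ^ 3 * (G 0 * ((((box 3 L) ×ˢ (box 3 L)).filter
          (fun p : Site 3 × Site 3 => p.2 - p.1 = 0)).card : ℝ))
      ≤ (2 * Real.pi) ^ 3 * (1 * (2 * L + 1) ^ 3) := by
        refine mul_le_mul_of_nonneg_left ?_ hπ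
        by_cases hG : 0 ≤ G 0
        · exact mul_le_mul hG0 hc' (by positivity) zero_le_one
        · push Not at hG
          calc G 0 * _ ≤ 0 := mul_nonpos_of_nonpos_of_nonneg hG.le (by positivity)
            _ ≤ 1 * (2 * L + 1) ^ 3 := by positivity
    _ = (2 * Real.pi) ^ 3 * (2 * L + 1) ^ 3 := by ring

/-- Parseval for the box block weight (stub A with `u = 1`). [folklore] -/
theorem integral_boxWeight_mul_approxSpectralDensity (G : Site 3 → ℝ) (hGev : ∀ w, G (-w) = G w)
    (L R : ℕ) :
    ∫ k in Set.pi Set.univ (fun _ : Fin 3 => Set.Icc (-Real.pi) Real.pi),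
        (∑ x ∈ box 3 R, ∑ x' ∈ box 3 R, Real.cos (phase 3 k (x' - x))) *
          (∑ z ∈ box 3 L, ∑ z' ∈ box 3 L, G (z' - z) * Real.cos (phase 3 k (z' - z)))
      = (2 * Real.pi) ^ 3 * ∑ x ∈ box 3 R, ∑ x' ∈ box 3 R, G (x' - x) *
          ((((box 3 L) ×ˢ (box 3 L)).filter (fun p : Site 3 × Site 3 => p.2 - p.1 = x' - x)).card : ℝ) := by
  have h := stub_spectralParseval G (box 3 R) (fun _ => (1 : ℝ)) L hGev
  simp only [one_mul] at h
  exact h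

/-- The box block weight is at most `(2R+1)⁶`. [folklore] -/
theorem boxWeight_le (R : ℕ) (k : Fin 3 → ℝ) :
    ∑ x ∈ box 3 R, ∑ x' ∈ box 3 R, Real.cos (phase 3 k (x' - x)) ≤ (2 * (R : ℝ) + 1) ^ 6 := by
  calc ∑ x ∈ box 3 R, ∑ x' ∈ box 3 R, Real.cos (phase 3 k (x' - x))
      ≤ ∑ x ∈ box 3 R, ∑ x' ∈ box 3 R, (1 : ℝ) :=
        Finset.sum_le_sum fun x _ => Finset.sum_le_sum fun x' _ => Real.cos_le_one _
    _ = (2 * (R : ℝ) + 1) ^ 6 := by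
        rw [Finset.sum_const, Finset.sum_const, card_box]
        simp only [mul_one, nsmul_eq_mul]
        push_cast; ring

/-- On the complement of the small cube `K_{ρ}` the Euclidean square is at least `ρ²`. [folklore] -/
theorem sq_le_sum_sq_of_not_mem_cube {ρ : ℝ} (hρ : 0 < ρ) {k : Fin 3 → ℝ}
    (hk : k ∉ Set.pi Set.univ (fun _ : Fin 3 => Set.Icc (-ρ) ρ)) :
    ρ ^ 2 ≤ ∑ i, k i ^ 2 := by
  simp only [Set.mem_pi, Set.mem_univ, Set.mem_Icc, forall_const, not_forall, not_and_or, not_le] at hk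
  obtain ⟨i, hi⟩ := hk
  have h1 : ρ ^ 2 ≤ k i ^ 2 := by
    rcases hi with hi | hi
    · nlinarith
    · nlinarith
  exact h1.trans (Finset.single_le_sum (f := fun i => k i ^ 2) (fun j _ => sq_nonneg _) (Finset.mem_univ i))

/-! ### The shell bound at level `L` -/

/-- **The two-scale shell bound at level `L`** (everything multiplied out by `(2L+1)³`). [folklore] -/
theorem spectralShell_level :
    ∀ (G : Site 3 → ℝ) (C₀ : ℝ), 0 ≤ C₀ →
    (∀ w, 0 ≤ G w) → (∀ w, G w ≤ 1) → (∀ w, G (-w) = G w) →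
    (∀ (σ : Equiv.Perm (Fin 3)) (x : Site 3), G (fun i => x (σ i)) = G x) →
    (∀ (j : Fin 3) (x : Site 3), G (Function.update x j (-x j)) = G x) →
    (∀ w : Site 3, w ≠ 0 → G w ≤ C₀ / (Site.supNorm w : ℝ)) →
    (∀ (A : Finset (Site 3)) (c : Site 3 → ℝ), 0 ≤ ∑ x ∈ A, ∑ x' ∈ A, c x * c x' * G (x' - x)) →
    ∀ (R' R L : ℕ), 1 ≤ R' → ∀ (y : Site 3), Site.supNorm y ≤ R' → ∀ (ρ₁ : ℝ), 0 < ρ₁ →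
    ρ₁ ≤ 1 / (2 * (R' : ℝ) + 1) →
    (1 / 160) * (2 * (R' : ℝ) + 1) ^ 6 * ((∑ i, ((y i : ℤ) : ℝ) ^ 2) / 3) * ρ₁ ^ 2 *
        (((2 * Real.pi) ^ 3 * (∑ x ∈ box 3 R, ∑ x' ∈ box 3 R, G (x' - x) *
            ((((box 3 L) ×ˢ (box 3 L)).filter (fun p : Site 3 × Site 3 => p.2 - p.1 = x' - x)).card : ℝ))
          - (40 * (64 * (2 * Real.pi) ^ 3 * (54 * C₀ + 2)) + 60 * (2 * Real.pi) ^ 3) *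
              (2 * (R : ℝ) + 1) ^ 4 * (2 * (R' : ℝ) + 1) * (2 * (L : ℝ) + 1) ^ 3) / (2 * (R : ℝ) + 1) ^ 6
          - (64 * (2 * Real.pi) ^ 3 * (54 * C₀ + 2)) * ρ₁ * (2 * (L : ℝ) + 1) ^ 3)
      ≤ (2 * Real.pi) ^ 3 * ∑ x ∈ (box 3 R' ∪ (box 3 R').image (· + y)),
          ∑ x' ∈ (box 3 R' ∪ (box 3 R').image (· + y)),
            ((if x ∈ box 3 R' then (1 : ℝ) else 0) - (if x - y ∈ box 3 R' then (1 : ℝ) else 0)) *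
            ((if x' ∈ box 3 R' then (1 : ℝ) else 0) - (if x' - y ∈ box 3 R' then (1 : ℝ) else 0)) *
            G (x' - x) *
            ((((box 3 L) ×ˢ (box 3 L)).filter (fun p : Site 3 × Site 3 => p.2 - p.1 = x' - x)).card : ℝ) := by
  intro G C₀ hC₀ hGnn hGle hGev hGperm hGflip hGenv hpos R' R L hR' y hy ρ₁ hρ₁ hρ₁₂
  -- names
  set K : Set (Fin 3 → ℝ) := Set.pi Set.univ (fun _ : Fin 3 => Set.Icc (-Real.pi) Real.pi) with hK
  set ρ₂ : ℝ := 1 / (2 * (R' : ℝ) + 1) with hρ₂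
  set K₁ : Set (Fin 3 → ℝ) := Set.pi Set.univ (fun _ : Fin 3 => Set.Icc (-ρ₁) ρ₁) with hK₁
  set K₂ : Set (Fin 3 → ℝ) := Set.pi Set.univ (fun _ : Fin 3 => Set.Icc (-ρ₂) ρ₂) with hK₂
  set g : (Fin 3 → ℝ) → ℝ := fun k =>
    ∑ z ∈ box 3 L, ∑ z' ∈ box 3 L, G (z' - z) * Real.cos (phase 3 k (z' - z)) with hg
  set W : (Fin 3 → ℝ) → ℝ := fun k => ∑ x ∈ box 3 R, ∑ x' ∈ box 3 R, Real.cos (phase 3 k (x' - x)) with hW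
  set S : Finset (Site 3) := box 3 R' ∪ (box 3 R').image (· + y) with hS
  set v : Site 3 → ℝ := fun x =>
    (if x ∈ box 3 R' then (1 : ℝ) else 0) - (if x - y ∈ box 3 R' then (1 : ℝ) else 0) with hv
  set V : (Fin 3 → ℝ) → ℝ := fun k => ∑ x ∈ S, ∑ x' ∈ S, v x * v x' * Real.cos (phase 3 k (x' - x)) with hV
  set C_M : ℝ := 64 * (2 * Real.pi) ^ 3 * (54 * C₀ + 2) with hCM
  set C_T : ℝ := (2 * Real.pi) ^ 3 with hCT
  set NL : ℝ := (2 * (L : ℝ) + 1) ^ 3 with hNL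
  have hπ3 : (3 : ℝ) < Real.pi := Real.pi_gt_three
  have hπpos : (0 : ℝ) < (2 * Real.pi) ^ 3 := by positivity
  have hR'pos : (0 : ℝ) < 2 * (R' : ℝ) + 1 := by positivity
  have hRpos : (0 : ℝ) < 2 * (R : ℝ) + 1 := by positivity
  have hρ₂pos : 0 < ρ₂ := by rw [hρ₂]; positivity
  have hρ₂le : ρ₂ ≤ 1 := by
    rw [hρ₂, div_le_one hR'pos]; linarith [(Nat.cast_nonneg R' : (0 : ℝ) ≤ R')]
  have hρ₁le : ρ₁ ≤ 1 := hρ₁₂.trans hρ₂le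
  have hCMnn : 0 ≤ C_M := by rw [hCM]; positivity
  have hCTnn : 0 ≤ C_T := by rw [hCT]; positivity
  have hNLpos : 0 < NL := by rw [hNL]; positivity
  have hNLeq : NL = ((2 * L + 1 : ℕ) : ℝ) ^ 3 := by rw [hNL]; push_cast; ring
  -- measurability / compactness / inclusions
  have hKm : ∀ r : ℝ, MeasurableSet (Set.pi Set.univ (fun _ : Fin 3 => Set.Icc (-r) r)) :=
    fun r => MeasurableSet.univ_pi fun _ => measurableSet_Icc
  have hKc : ∀ r : ℝ, IsCompact (Set.pi Set.univ (fun _ : Fin 3 => Set.Icc (-r) r)) :=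
    fun r => isCompact_univ_pi fun _ => isCompact_Icc
  have hK₂K : K₂ ⊆ K := Set.pi_mono fun _ _ => Set.Icc_subset_Icc (by linarith) (by linarith)
  have hK₁K₂ : K₁ ⊆ K₂ := Set.pi_mono fun _ _ => Set.Icc_subset_Icc (by linarith) (by linarith)
  -- continuity
  have hgc : Continuous g := continuous_approxSpectralDensity G L
  have hWc : Continuous W := spectralTailBound_continuous_weight R
  have hVc : Continuous V := by
    simp only [hV]
    refine continuous_finsetSum _ fun x _ => continuous_finsetSum _ fun x' _ => ?_
    exact continuous_const.mul (Real.continuous_cos.comp (EtaBoundsTransfer.continuous_phase _))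
  have hθc : Continuous fun k : Fin 3 → ℝ => (phase 3 k y) ^ 2 := (EtaBoundsTransfer.continuous_phase _).pow 2
  have hsqc : Continuous fun k : Fin 3 → ℝ => ∑ i, k i ^ 2 := by fun_prop
  -- nonnegativity
  have hg0 : ∀ k, 0 ≤ g k := fun k => approxSpectralDensity_nonneg G hpos L k
  have hV0 : ∀ k, 0 ≤ V k := by
    intro k
    have h := shiftedBoxWeight_eq (d := 3) R' y k
    simp only [hV, hS, hv]
    rw [h]
    have h1 : 0 ≤ 1 - Real.cos (phase 3 k y) := by linarith [Real.cos_le_one (phase 3 k y)]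
    positivity
  have hW0 : ∀ k, 0 ≤ W k := fun k => spectralBallMass_weight_nonneg R k
  -- (F2) count bound, (F3) Parseval for boxes, (F4) ball mass, (F5) total mass, (F6) tail
  have hcount : ∀ w : Site 3,
      (((box 3 L) ×ˢ (box 3 L)).filter (fun p : Site 3 × Site 3 => p.2 - p.1 = w)).card ≤ (2 * L + 1) ^ 3 :=
    fun w => autocorrelationCount_le w L
  have hpars : ∀ Rb : ℕ, ∫ k in K, (∑ x ∈ box 3 Rb, ∑ x' ∈ box 3 Rb, Real.cos (phase 3 k (x' - x))) * g k
      = (2 * Real.pi) ^ 3 * ∑ x ∈ box 3 Rb, ∑ x' ∈ box 3 Rb, G (x' - x) *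
          ((((box 3 L) ×ˢ (box 3 L)).filter (fun p : Site 3 × Site 3 => p.2 - p.1 = x' - x)).card : ℝ) :=
    fun Rb => integral_boxWeight_mul_approxSpectralDensity G hGev L Rb
  have hχ : ∀ Rb : ℕ, ∑ x ∈ box 3 Rb, ∑ x' ∈ box 3 Rb, G (x' - x) ≤ (54 * C₀ + 2) * (2 * Rb + 1) ^ 5 :=
    (stub_boxDoubleSumBounds G hGnn).1 C₀ hC₀ hGenv (hGle 0)
  have hball : ∀ ρ : ℝ, 0 < ρ → ρ ≤ 1 → ∫ k in Set.pi Set.univ (fun _ : Fin 3 => Set.Icc (-ρ) ρ), g k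
      ≤ C_M * ρ * (2 * L + 1) ^ 3 := by
    intro ρ hρ hρ1
    have h := stub_spectralBallMass G (54 * C₀ + 2) L hGnn (by positivity) hχ hg0 hcount hpars ρ hρ hρ1
    rw [hCM]
    calc _ ≤ 64 * (2 * Real.pi) ^ 3 * (54 * C₀ + 2) * ρ * (2 * L + 1) ^ 3 := h
      _ = _ := by ring
  have htot : ∫ k in K, g k ≤ C_T * (2 * L + 1) ^ 3 := by
    rw [hCT]; exact integral_approxSpectralDensity_le G hGev (hGle 0) L
  have htail : ∫ k in K \ K₂, W k * g k ≤ (40 * C_M + 60 * C_T) * (2 * R + 1) ^ 4 / ρ₂ * (2 * L + 1) ^ 3 :=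
    stub_spectralTailBound G C_M C_T L R ρ₂ hCMnn hCTnn hρ₂pos hρ₂le hg0 hball htot
  -- (F7) Parseval for `v`
  have hparsV : ∫ k in K, V k * g k = (2 * Real.pi) ^ 3 * ∑ x ∈ S, ∑ x' ∈ S, v x * v x' * G (x' - x) *
      ((((box 3 L) ×ˢ (box 3 L)).filter (fun p : Site 3 × Site 3 => p.2 - p.1 = x' - x)).card : ℝ) :=
    stub_spectralParseval G S v L hGev
  -- (F8) lower bound for `V` on `K₂`
  have hVlow : ∀ k ∈ K₂, (2 * (R' : ℝ) + 1) ^ 6 / 64 * ((2 / 5) * (phase 3 k y) ^ 2) ≤ V k := by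
    intro k hk
    have hkj : ∀ j, |k j| ≤ 1 / (2 * (R' : ℝ) + 1) := by
      intro j
      simp only [hK₂, Set.mem_pi, Set.mem_univ, Set.mem_Icc, forall_const] at hk
      exact abs_le.2 (hk j)
    exact stub_shiftedBoxWeightLower R' y k hR' hy hkj
  -- (F10) isotropy on the shell
  have hiso : ∫ k in K₂ \ K₁, (phase 3 k y) ^ 2 * g k
      = ((∑ i, ((y i : ℤ) : ℝ) ^ 2) / 3) * ∫ k in K₂ \ K₁, (∑ i, k i ^ 2) * g k := by
    have h := (stub_spectralIsotropy).2 g ρ₁ ρ₂ (fun i => ((y i : ℤ) : ℝ)) hgc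
      (fun σ k => ((stub_spectralIsotropy).1 G L hGperm hGflip).1 σ k)
      (fun j k => ((stub_spectralIsotropy).1 G L hGperm hGflip).2 j k)
    simpa only [phase] using h
  -- (F11) `W ≤ (2R+1)⁶`
  have hWle : ∀ k, W k ≤ (2 * (R : ℝ) + 1) ^ 6 := fun k => boxWeight_le R k
  -- integrability
  have hIK : ∀ {f : (Fin 3 → ℝ) → ℝ}, Continuous f → ∀ (s : Set (Fin 3 → ℝ)), s ⊆ K → IntegrableOn f s volume := by
    intro f hf s hs
    exact (hf.continuousOn.integrableOn_compact (hKc Real.pi)).mono_set hs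
  have hShK : K₂ \ K₁ ⊆ K := Set.sdiff_subset.trans hK₂K
  -- the chain
  -- (c2) ∫_K V g ≥ ∫_{Sh} V g
  have c2 : ∫ k in K₂ \ K₁, V k * g k ≤ ∫ k in K, V k * g k :=
    setIntegral_mono_set (hIK (hVc.mul hgc) K Set.Subset.rfl)
      (Eventually.of_forall fun k => mul_nonneg (hV0 k) (hg0 k)) (Eventually.of_forall hShK)
  -- (c3) on the shell, V g ≥ cst θ² g
  have c3 : ∫ k in K₂ \ K₁, ((2 * (R' : ℝ) + 1) ^ 6 / 64 * (2 / 5)) * ((phase 3 k y) ^ 2 * g k)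
      ≤ ∫ k in K₂ \ K₁, V k * g k := by
    refine setIntegral_mono_on (hIK (continuous_const.mul (hθc.mul hgc)) _ hShK)
      (hIK (hVc.mul hgc) _ hShK) ((hKm ρ₂).diff (hKm ρ₁)) fun k hk => ?_
    have h := hVlow k hk.1
    calc (2 * (R' : ℝ) + 1) ^ 6 / 64 * (2 / 5) * ((phase 3 k y) ^ 2 * g k)
        = ((2 * (R' : ℝ) + 1) ^ 6 / 64 * ((2 / 5) * (phase 3 k y) ^ 2)) * g k := by ring
      _ ≤ V k * g k := mul_le_mul_of_nonneg_right h (hg0 k)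
  have c3' : ∫ k in K₂ \ K₁, ((2 * (R' : ℝ) + 1) ^ 6 / 64 * (2 / 5)) * ((phase 3 k y) ^ 2 * g k)
      = ((2 * (R' : ℝ) + 1) ^ 6 / 64 * (2 / 5)) * ∫ k in K₂ \ K₁, (phase 3 k y) ^ 2 * g k :=
    integral_const_mul _ _
  -- (c5) |k|² ≥ ρ₁² on the shell
  have c5 : ∫ k in K₂ \ K₁, ρ₁ ^ 2 * g k ≤ ∫ k in K₂ \ K₁, (∑ i, k i ^ 2) * g k := by
    refine setIntegral_mono_on (hIK (continuous_const.mul hgc) _ hShK) (hIK (hsqc.mul hgc) _ hShK)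
      ((hKm ρ₂).diff (hKm ρ₁)) fun k hk => ?_
    exact mul_le_mul_of_nonneg_right (sq_le_sum_sq_of_not_mem_cube hρ₁ hk.2) (hg0 k)
  have c5' : ∫ k in K₂ \ K₁, ρ₁ ^ 2 * g k = ρ₁ ^ 2 * ∫ k in K₂ \ K₁, g k := integral_const_mul _ _
  -- (c6) shell = difference of cubes
  have c6 : ∫ k in K₂ \ K₁, g k = (∫ k in K₂, g k) - ∫ k in K₁, g k :=
    setIntegral_sdiff (hKm ρ₁) (hIK hgc K₂ hK₂K) hK₁K₂
  -- (c7) small-cube mass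
  have c7 : ∫ k in K₁, g k ≤ C_M * ρ₁ * (2 * L + 1) ^ 3 := hball ρ₁ hρ₁ hρ₁le
  -- (c8) ∫_{K₂} W g ≤ (2R+1)⁶ ∫_{K₂} g
  have c8 : ∫ k in K₂, W k * g k ≤ ∫ k in K₂, (2 * (R : ℝ) + 1) ^ 6 * g k := by
    refine setIntegral_mono_on (hIK (hWc.mul hgc) K₂ hK₂K) (hIK (continuous_const.mul hgc) K₂ hK₂K)
      (hKm ρ₂) fun k _ => ?_
    exact mul_le_mul_of_nonneg_right (hWle k) (hg0 k)
  have c8' : ∫ k in K₂, (2 * (R : ℝ) + 1) ^ 6 * g k = (2 * (R : ℝ) + 1) ^ 6 * ∫ k in K₂, g k :=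
    integral_const_mul _ _
  -- (c9) ∫_{K₂} W g = ∫_K W g − ∫_{K∖K₂} W g
  have c9 : ∫ k in K \ K₂, W k * g k = (∫ k in K, W k * g k) - ∫ k in K₂, W k * g k :=
    setIntegral_sdiff (hKm ρ₂) (hIK (hWc.mul hgc) K Set.Subset.rfl) hK₂K
  -- (c10) main and tail
  have c10 : ∫ k in K, W k * g k = (2 * Real.pi) ^ 3 * ∑ x ∈ box 3 R, ∑ x' ∈ box 3 R, G (x' - x) *
      ((((box 3 L) ×ˢ (box 3 L)).filter (fun p : Site 3 × Site 3 => p.2 - p.1 = x' - x)).card : ℝ) :=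
    hpars R
  have htail' : ∫ k in K \ K₂, W k * g k
      ≤ (40 * C_M + 60 * C_T) * (2 * (R : ℝ) + 1) ^ 4 * (2 * (R' : ℝ) + 1) * NL := by
    have e : (40 * C_M + 60 * C_T) * (2 * R + 1) ^ 4 / ρ₂ * (2 * L + 1) ^ 3
        = (40 * C_M + 60 * C_T) * (2 * (R : ℝ) + 1) ^ 4 * (2 * (R' : ℝ) + 1) * NL := by
      rw [hρ₂, hNL]; field_simp
    rw [← e]; exact htail
  -- assemble the lower bound for ∫_{Sh} g
  have hSh : ((2 * Real.pi) ^ 3 * (∑ x ∈ box 3 R, ∑ x' ∈ box 3 R, G (x' - x) *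
            ((((box 3 L) ×ˢ (box 3 L)).filter (fun p : Site 3 × Site 3 => p.2 - p.1 = x' - x)).card : ℝ))
          - (40 * C_M + 60 * C_T) * (2 * (R : ℝ) + 1) ^ 4 * (2 * (R' : ℝ) + 1) * NL) / (2 * (R : ℝ) + 1) ^ 6
        - C_M * ρ₁ * NL ≤ ∫ k in K₂ \ K₁, g k := by
    have h1 : (2 * (R : ℝ) + 1) ^ 6 * ∫ k in K₂, g k ≥
        (2 * Real.pi) ^ 3 * (∑ x ∈ box 3 R, ∑ x' ∈ box 3 R, G (x' - x) *
            ((((box 3 L) ×ˢ (box 3 L)).filter (fun p : Site 3 × Site 3 => p.2 - p.1 = x' - x)).card : ℝ))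
          - (40 * C_M + 60 * C_T) * (2 * (R : ℝ) + 1) ^ 4 * (2 * (R' : ℝ) + 1) * NL := by
      have := c8.trans_eq c8'
      linarith [c9, c10, htail']
    have h2 : ((2 * Real.pi) ^ 3 * (∑ x ∈ box 3 R, ∑ x' ∈ box 3 R, G (x' - x) *
            ((((box 3 L) ×ˢ (box 3 L)).filter (fun p : Site 3 × Site 3 => p.2 - p.1 = x' - x)).card : ℝ))
          - (40 * C_M + 60 * C_T) * (2 * (R : ℝ) + 1) ^ 4 * (2 * (R' : ℝ) + 1) * NL) / (2 * (R : ℝ) + 1) ^ 6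
        ≤ ∫ k in K₂, g k := by
      rw [div_le_iff₀ (by positivity)]
      linarith
    have h3 : ∫ k in K₁, g k ≤ C_M * ρ₁ * NL := by rw [hNL]; exact c7
    rw [c6]
    linarith
  -- assemble everything
  have hcst : (0 : ℝ) ≤ (2 * (R' : ℝ) + 1) ^ 6 / 64 * (2 / 5) := by positivity
  have hy2 : (0 : ℝ) ≤ (∑ i, ((y i : ℤ) : ℝ) ^ 2) / 3 := by positivity
  have hmain : ((2 * (R' : ℝ) + 1) ^ 6 / 64 * (2 / 5)) * (((∑ i, ((y i : ℤ) : ℝ) ^ 2) / 3) *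
      (ρ₁ ^ 2 * ∫ k in K₂ \ K₁, g k)) ≤ ∫ k in K, V k * g k := by
    calc ((2 * (R' : ℝ) + 1) ^ 6 / 64 * (2 / 5)) * (((∑ i, ((y i : ℤ) : ℝ) ^ 2) / 3) *
          (ρ₁ ^ 2 * ∫ k in K₂ \ K₁, g k))
        ≤ ((2 * (R' : ℝ) + 1) ^ 6 / 64 * (2 / 5)) * (((∑ i, ((y i : ℤ) : ℝ) ^ 2) / 3) *
          ∫ k in K₂ \ K₁, (∑ i, k i ^ 2) * g k) := by
          refine mul_le_mul_of_nonneg_left (mul_le_mul_of_nonneg_left ?_ hy2) hcst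
          rw [← c5']; exact c5
      _ = ((2 * (R' : ℝ) + 1) ^ 6 / 64 * (2 / 5)) * ∫ k in K₂ \ K₁, (phase 3 k y) ^ 2 * g k := by
          rw [hiso]
      _ ≤ ∫ k in K₂ \ K₁, V k * g k := by rw [← c3']; exact c3
      _ ≤ ∫ k in K, V k * g k := c2
  rw [hparsV] at hmain
  have hfac : (0 : ℝ) ≤ (1 / 160) * (2 * (R' : ℝ) + 1) ^ 6 * ((∑ i, ((y i : ℤ) : ℝ) ^ 2) / 3) * ρ₁ ^ 2 := by
    positivity
  calc (1 / 160) * (2 * (R' : ℝ) + 1) ^ 6 * ((∑ i, ((y i : ℤ) : ℝ) ^ 2) / 3) * ρ₁ ^ 2 *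
        (((2 * Real.pi) ^ 3 * (∑ x ∈ box 3 R, ∑ x' ∈ box 3 R, G (x' - x) *
            ((((box 3 L) ×ˢ (box 3 L)).filter (fun p : Site 3 × Site 3 => p.2 - p.1 = x' - x)).card : ℝ))
          - (40 * (64 * (2 * Real.pi) ^ 3 * (54 * C₀ + 2)) + 60 * (2 * Real.pi) ^ 3) *
              (2 * (R : ℝ) + 1) ^ 4 * (2 * (R' : ℝ) + 1) * (2 * (L : ℝ) + 1) ^ 3) / (2 * (R : ℝ) + 1) ^ 6
          - (64 * (2 * Real.pi) ^ 3 * (54 * C₀ + 2)) * ρ₁ * (2 * (L : ℝ) + 1) ^ 3)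
      ≤ (1 / 160) * (2 * (R' : ℝ) + 1) ^ 6 * ((∑ i, ((y i : ℤ) : ℝ) ^ 2) / 3) * ρ₁ ^ 2 *
          ∫ k in K₂ \ K₁, g k := by
        refine mul_le_mul_of_nonneg_left ?_ hfac
        have e1 : (40 * (64 * (2 * Real.pi) ^ 3 * (54 * C₀ + 2)) + 60 * (2 * Real.pi) ^ 3)
            = 40 * C_M + 60 * C_T := by rw [hCM, hCT]
        have e2 : (64 * (2 * Real.pi) ^ 3 * (54 * C₀ + 2)) = C_M := by rw [hCM]
        have e3 : (2 * (L : ℝ) + 1) ^ 3 = NL := by rw [hNL]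
        rw [e1, e2, e3]
        exact hSh
    _ = ((2 * (R' : ℝ) + 1) ^ 6 / 64 * (2 / 5)) * (((∑ i, ((y i : ℤ) : ℝ) ^ 2) / 3) *
          (ρ₁ ^ 2 * ∫ k in K₂ \ K₁, g k)) := by ring
    _ ≤ _ := hmain

end Summit.CriticalPhenomena.Ising3DConformalLimit.Cruxes.DirectCorrelationStableTail.DiffusiveBranchIsNonsaturation

end
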